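import Mathlib
import Literature.Analysis.FluidPDE.ClassicalSolution
import Literature.Analysis.FluidPDE.LerayHopf
import Literature.Analysis.FluidPDE.LerayHopfH1Test
import Summits.NavierStokesRegularity.NavierStokesRegularity.Theses.L3TimeExponentPincer
import Summits.NavierStokesRegularity.NavierStokesRegularity.Theorems.L3TimeExponentPincerJawFullMorrey
import HarnessLib.Audit
import HarnessLib

/-!
# L3TimeExponentPincer — the mixed-norm face of the first bite

Support kernel for the crux `L3CascadeJaw` (`∃ q > 4, u ∈ L^q_t L³_x` near a first singular
time; route `L3TimeExponentPincer`, memo ROUND-10 §2, face F3): a time-integrability hypothesis in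
ANY Lebesgue space `L^p_x` with `p > 3` converts into one in `L³_x` by interpolation with the
Leray–Hopf energy bound `‖u(t)‖₂² ≤ 2E(0)`:

* `lintegral_enorm_cube_le_interpolate` — `∫|w|³ ≤ (∫|w|²)^{(p-3)/(p-2)} (∫|w|^p)^{1/(p-2)}` (`p > 3`);
* `jaw_of_mixedIntegrability` — `∫_{T₁}^{T} (∫|u(t)|^p)^m dt < ∞` with `p > 3`, `m ≥ 0` gives
  `u ∈ L^{q'}_t L³_x` on some `(T₂, T)` with `q' = 3 (p - 2) m`; in Ladyzhenskaya–Prodi–Serrin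
  variables (`m = q/p`, hypothesis `u ∈ L^q_t L^p_x`) this is `q' = 3 q (p-2) / p`;
* `l3Bite_of_mixedBite` — hence a FIRST BITE (`q' > 4`) as soon as `m > 4 / (3 (p - 2))`, i.e.
  `2/q + 3/p < 3/2` in LPS variables: every mixed-norm bound strictly above the ENERGY line
  `2/q + 3/p = 3/2` (not the Serrin line `= 1`) already pays the first rung of the crux.

No statement here is specific to blow-up; all are unconditional consequences of the frame
hypotheses `IsClassicalNSSolutionOn` + `IsLerayHopfOn`.
-/

namespace Summit.NavierStokesRegularity.NavierStokesRegularity.Theorems.L3TimeExponentPincerMixedNormBite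

open MeasureTheory Set Literature.Analysis.FluidPDE
open scoped ENNReal NNReal

/-- Lebesgue interpolation `2 < 3 < p`: `∫|w|³ ≤ (∫|w|²)^{(p-3)/(p-2)} · (∫|w|^p)^{1/(p-2)}`. -/
theorem lintegral_enorm_cube_le_interpolate {α F : Type*} [MeasurableSpace α] {μ : Measure α}
    [NormedAddCommGroup F] {w : α → F} (hw : AEMeasurable (fun x => ‖w x‖ₑ) μ)
    {p : ℝ} (hp : 3 < p) :
    ∫⁻ x, ‖w x‖ₑ ^ (3 : ℕ) ∂μ ≤
      (∫⁻ x, ‖w x‖ₑ ^ 2 ∂μ) ^ ((p - 3) / (p - 2)) * (∫⁻ x, ‖w x‖ₑ ^ p ∂μ) ^ (1 / (p - 2)) := by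
  have h := lintegral_rpow_interpolate (μ := μ) hw (a := 2) (b := p) (r := 3)
    (by norm_num) (by linarith) (by norm_num) hp.le
  have e3 : (fun x => ‖w x‖ₑ ^ (3 : ℝ)) = fun x => ‖w x‖ₑ ^ (3 : ℕ) := by
    funext x
    rw [show (3 : ℝ) = ((3 : ℕ) : ℝ) by norm_num, ENNReal.rpow_natCast]
  have e2 : (fun x => ‖w x‖ₑ ^ (2 : ℝ)) = fun x => ‖w x‖ₑ ^ (2 : ℕ) := by
    funext x
    rw [show (2 : ℝ) = ((2 : ℕ) : ℝ) by norm_num, ENNReal.rpow_natCast]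
  have e32 : (3 : ℝ) - 2 = 1 := by norm_num
  simp only [e3, e2, e32] at h
  exact h

/-- **Mixed-norm integrability ⇒ `L^{q'}_t L³_x`.** If `∫_{T₁}^{T} (∫|u(t)|^p)^m dt < ∞` for some
`p > 3`, `m ≥ 0`, then `u ∈ L^{q'}_t L³_x` on some `(T₂,T)` with `q' = 3 (p-2) m` (interpolation
with the Leray–Hopf energy bound). In LPS variables (`m = q/p`): `u ∈ L^q_t L^p_x ⇒ u ∈ L^{3q(p-2)/p}_t L³_x`. -/
theorem jaw_of_mixedIntegrability {ν T : ℝ} (hν : 0 < ν) (hT : 0 < T)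
    {u : ℝ → (EuclideanSpace ℝ (Fin 3)) → (EuclideanSpace ℝ (Fin 3))} {pr : ℝ → (EuclideanSpace ℝ (Fin 3)) → ℝ}
    (hcl : IsClassicalNSSolutionOn (Ico 0 T) ν 0 u pr) (hLH : IsLerayHopfOn T ν 0 (u 0) u)
    {p m : ℝ} (hp : 3 < p) (hm : 0 ≤ m)
    (hint : ∃ T₁ < T, ∫⁻ t in Ioo T₁ T, (∫⁻ x, ‖u t x‖ₑ ^ p) ^ m < ⊤) :
    ∃ T₂ ∈ Ioo 0 T, (∫⁻ t in Ioo T₂ T, eLpNorm (u t) 3 volume ^ (3 * (p - 2) * m)) < ⊤ := by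
  obtain ⟨T₁, hT₁, hint⟩ := hint
  have hp2 : 0 < p - 2 := by linarith
  have hp3 : 0 ≤ p - 3 := by linarith
  set E₀ : ℝ≥0∞ := ENNReal.ofReal (2 * VectorCalculus.kineticEnergy (u 0)) with hE₀
  set A : ℝ≥0∞ := E₀ ^ ((p - 3) * m) with hA
  have hAtop : A ≠ ⊤ := ENNReal.rpow_ne_top_of_nonneg (mul_nonneg hp3 hm) ENNReal.ofReal_ne_top
  set T₂ : ℝ := max T₁ (T / 2) with hT₂
  have hT₂mem : T₂ ∈ Ioo 0 T := ⟨lt_max_of_lt_right (by linarith), max_lt hT₁ (by linarith)⟩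
  have hpt : ∀ t ∈ Ioo T₂ T,
      eLpNorm (u t) 3 volume ^ (3 * (p - 2) * m) ≤ A * (∫⁻ x, ‖u t x‖ₑ ^ p) ^ m := by
    intro t ht
    have ht0 : 0 < t := hT₂mem.1.trans ht.1
    have htc : t ∈ Ico 0 T := ⟨ht0.le, ht.2⟩
    have hen : ∫⁻ x, ‖u t x‖ₑ ^ 2 ≤ E₀ := hLH.lintegral_enorm_sq_le hν.le ⟨ht0.le, ht.2.le⟩
    have hmeas : AEMeasurable (fun x => ‖u t x‖ₑ) (volume : Measure (EuclideanSpace ℝ (Fin 3))) :=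
      (hcl.contDiff_velocity htc).continuous.measurable.enorm.aemeasurable
    have h1 := lintegral_enorm_cube_le_interpolate (μ := volume) hmeas hp
    have h2 : ∫⁻ x, ‖u t x‖ₑ ^ (3 : ℕ) ≤
        E₀ ^ ((p - 3) / (p - 2)) * (∫⁻ x, ‖u t x‖ₑ ^ p) ^ (1 / (p - 2)) :=
      h1.trans (mul_le_mul' (ENNReal.rpow_le_rpow hen (div_nonneg hp3 hp2.le)) le_rfl)
    have hexp : 3 * (p - 2) * m / 3 = (p - 2) * m := by ring
    have hnn : 0 ≤ (p - 2) * m := mul_nonneg hp2.le hm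
    rw [L3TimeExponentPincerJawFullMorrey.eLpNorm_three_rpow_eq volume (u t) (3 * (p - 2) * m), hexp]
    calc (∫⁻ x, ‖u t x‖ₑ ^ (3 : ℕ)) ^ ((p - 2) * m)
        ≤ (E₀ ^ ((p - 3) / (p - 2)) * (∫⁻ x, ‖u t x‖ₑ ^ p) ^ (1 / (p - 2))) ^ ((p - 2) * m) :=
          ENNReal.rpow_le_rpow h2 hnn
      _ = A * (∫⁻ x, ‖u t x‖ₑ ^ p) ^ m := by
          rw [ENNReal.mul_rpow_of_nonneg _ _ hnn, ← ENNReal.rpow_mul, ← ENNReal.rpow_mul, hA]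
          congr 2
          · field_simp
          · field_simp
  refine ⟨T₂, hT₂mem, ?_⟩
  calc ∫⁻ t in Ioo T₂ T, eLpNorm (u t) 3 volume ^ (3 * (p - 2) * m)
      ≤ ∫⁻ t in Ioo T₂ T, A * (∫⁻ x, ‖u t x‖ₑ ^ p) ^ m := setLIntegral_mono' measurableSet_Ioo hpt
    _ = A * ∫⁻ t in Ioo T₂ T, (∫⁻ x, ‖u t x‖ₑ ^ p) ^ m := lintegral_const_mul' _ _ hAtop
    _ ≤ A * ∫⁻ t in Ioo T₁ T, (∫⁻ x, ‖u t x‖ₑ ^ p) ^ m :=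
        mul_le_mul' le_rfl (lintegral_mono_set (Ioo_subset_Ioo_left (le_max_left _ _)))
    _ < ⊤ := ENNReal.mul_lt_top hAtop.lt_top hint

/-- **First bite in a mixed norm ⇒ first bite in `L³`.** A bound `∫_{T₁}^{T} (∫|u(t)|^p)^m dt < ∞`
with `p > 3` and `m > 4 / (3 (p - 2))` — in LPS variables `u ∈ L^q_t L^p_x` with
`2/q + 3/p < 3/2`, i.e. strictly above the ENERGY line — gives `u ∈ L^{q'}_t L³_x` near `T` for some
`q' > 4`, the first rung of the crux `L3CascadeJaw`. -/
theorem l3Bite_of_mixedBite {ν T : ℝ} (hν : 0 < ν) (hT : 0 < T)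
    {u : ℝ → (EuclideanSpace ℝ (Fin 3)) → (EuclideanSpace ℝ (Fin 3))} {pr : ℝ → (EuclideanSpace ℝ (Fin 3)) → ℝ}
    (hcl : IsClassicalNSSolutionOn (Ico 0 T) ν 0 u pr) (hLH : IsLerayHopfOn T ν 0 (u 0) u)
    {p m : ℝ} (hp : 3 < p) (hm : 4 / (3 * (p - 2)) < m)
    (hint : ∃ T₁ < T, ∫⁻ t in Ioo T₁ T, (∫⁻ x, ‖u t x‖ₑ ^ p) ^ m < ⊤) :
    ∃ q : ℝ, 4 < q ∧ ∃ T₂ ∈ Ioo 0 T, (∫⁻ t in Ioo T₂ T, eLpNorm (u t) 3 volume ^ q) < ⊤ := by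
  have hp2 : 0 < 3 * (p - 2) := by linarith
  have hm0 : 0 ≤ m := ((div_nonneg (by norm_num) hp2.le).trans_lt hm).le
  refine ⟨3 * (p - 2) * m, ?_, jaw_of_mixedIntegrability hν hT hcl hLH hp hm0 hint⟩
  have := (div_lt_iff₀ hp2).1 hm
  linarith

end Summit.NavierStokesRegularity.NavierStokesRegularity.Theorems.L3TimeExponentPincerMixedNormBite
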